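import Summits.RiemannHypothesis.RiemannHypothesis.Theorems.JensenLogBandArcSaddleDen
import Summits.RiemannHypothesis.RiemannHypothesis.Theorems.JensenLogBandArcDescent
import HarnessLib

/-!
# Monotonicity of `‖γ̃‖` along horizontal and vertical lines (BAND crux, far-zone input F1)

RH ladder column JENSEN, rung J-P(P3) «log band», BAND crux `XiDerivBandRealAllRates`
(stmt-RiemannHypothesis-19913) of route «JensenLogBand», line «band-one-window» (u-arc reshape,
lead rh-jensen-prover g7) — FAR-ZONE input of HOME/rh-jensen-prover/g7-work/LINE-PLAN.md §8.2
(«FAR ZONE … needs the KKL comparison»). RH-FREE `Γ`-factor calculus. WHAT THIS IS NOT: nothing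
here bears on zeros of `ζ` or the truth of RH.

For the `Γ`-factor `γ̃(s) = ½ s(s−1) Γℝ(s)` of `ξ` (`LogBandArc.xiGammaFactor`) and its logarithmic
derivative `λ′ = γ̃′/γ̃` (eng-2 g5's Stirling file: `‖λ′(s) − ½ Log(s/2π)‖ ≤ 6/Im s` for
`Im s ≥ 2`, `Re s ≥ 0`):

* `hasDerivAt_log_norm_xiGammaFactor_horizontal` / `…_vertical` —
  `d/dσ log ‖γ̃(σ+it)‖ = Re λ′(σ+it)`, `d/dt log ‖γ̃(σ+it)‖ = −Im λ′(σ+it)`;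
* `re_im_logDeriv_xiGammaFactor_bounds` — `Re λ′ ∈ [½ log(‖s‖/2π) − 6/Im s, ½ log(‖s‖/2π) + 6/Im s]`,
  `Im λ′ ∈ [−6/Im s, π/4 + 6/Im s]` (`Re s > 0`, `Im s ≥ 2`);
* **horizontal comparison** `norm_xiGammaFactor_le_of_re_le`: for `0 < σ₁ ≤ σ₂`, `t ≥ 2`,
  `‖γ̃(σ₁+it)‖ ≤ ‖γ̃(σ₂+it)‖ · exp(−(σ₂−σ₁)(ℓ_t/2 − 6/t))` (`ℓ_t = LogBandArc.ell t = log(t/2π)`)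
  — the factor `e^{−aℓ}` / `e^{−δ₁ℓ}` of the far-zone comparison — and the reverse bound
  `norm_xiGammaFactor_le_of_le_re`: `‖γ̃(σ₂+it)‖ ≤ ‖γ̃(σ₁+it)‖ · exp((σ₂−σ₁)(½ log((σ₂+t)/2π) + 6/t))`;
* **vertical comparison** `norm_xiGammaFactor_vertical_le`: for `σ > 0`, `2 ≤ t₁ ≤ t₂`,
  `‖γ̃(σ+it₂)‖ ≤ ‖γ̃(σ+it₁)‖ e^{(6/t₁)(t₂−t₁)}` and `‖γ̃(σ+it₁)‖ ≤ ‖γ̃(σ+it₂)‖ e^{(π/4+6/t₁)(t₂−t₁)}`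
  (heights `T ± h` on one arc differ by `O(h)`, so by bounded factors in the far zone).

(prover-rh-jensen-eng-2-g6-0, 2026-08-27.)
-/

noncomputable section

-- single-problem summit: `Summit.RiemannHypothesis.RiemannHypothesis.…` is the tree convention
set_option linter.dupNamespace false

open Complex Real Set

namespace Summit.RiemannHypothesis.RiemannHypothesis.Theorems.JensenPolynomials.LogBandArc

open Literature.NumberTheory.LFunctions

/-! ## Derivatives of `γ̃` and `log ‖γ̃‖` along horizontal and vertical lines -/

/-- `d/dσ γ̃(σ + it) = γ̃′(σ + it)` for `σ > 0`. RH-FREE. [folklore] -/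
theorem hasDerivAt_xiGammaFactor_horizontal {σ : ℝ} (t : ℝ) (hσ : 0 < σ) :
    HasDerivAt (fun x : ℝ => xiGammaFactor ((x : ℂ) + t * I))
      (deriv xiGammaFactor ((σ : ℂ) + t * I)) σ := by
  have hre : 0 < ((σ : ℂ) + t * I).re := by simp [hσ]
  have hd : HasDerivAt xiGammaFactor (deriv xiGammaFactor ((σ : ℂ) + t * I))
      ((σ : ℂ) + t * I) := (differentiableAt_xiGammaFactor hre).hasDerivAt
  have haff : HasDerivAt (fun z : ℂ => z + t * I) 1 (σ : ℂ) := (hasDerivAt_id _).add_const _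
  have hcomp := hd.comp (σ : ℂ) haff
  rw [mul_one] at hcomp
  exact hcomp.comp_ofReal

/-- `d/dt γ̃(σ + it) = i γ̃′(σ + it)` for `σ > 0`. RH-FREE. [folklore] -/
theorem hasDerivAt_xiGammaFactor_vertical {σ : ℝ} (t : ℝ) (hσ : 0 < σ) :
    HasDerivAt (fun y : ℝ => xiGammaFactor ((σ : ℂ) + y * I))
      (deriv xiGammaFactor ((σ : ℂ) + t * I) * I) t := by
  have hre : 0 < ((σ : ℂ) + t * I).re := by simp [hσ]
  have hd : HasDerivAt xiGammaFactor (deriv xiGammaFactor ((σ : ℂ) + t * I))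
      ((σ : ℂ) + t * I) := (differentiableAt_xiGammaFactor hre).hasDerivAt
  have haff : HasDerivAt (fun z : ℂ => (σ : ℂ) + z * I) I (t : ℂ) := by
    simpa using ((hasDerivAt_id (t : ℂ)).mul_const I).const_add (σ : ℂ)
  have hcomp := hd.comp (t : ℂ) haff
  exact hcomp.comp_ofReal

/-- A point `σ + it` with `t ≠ 0` is not the pole `1` of `ζ`/zero of `s − 1`. [folklore] -/
theorem ofReal_add_mul_I_ne_one {σ t : ℝ} (ht : t ≠ 0) : ((σ : ℂ) + t * I) ≠ 1 := by
  intro h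
  have := congrArg Complex.im h
  simp at this
  exact ht this

/-- **`d/dσ log ‖γ̃(σ + it)‖ = Re λ′(σ + it)`** (`λ′ = γ̃′/γ̃ = logDeriv γ̃`) for `σ > 0`, `t ≠ 0`.
RH-FREE. [folklore] -/
theorem hasDerivAt_log_norm_xiGammaFactor_horizontal {σ : ℝ} {t : ℝ} (hσ : 0 < σ) (ht : t ≠ 0) :
    HasDerivAt (fun x : ℝ => Real.log ‖xiGammaFactor ((x : ℂ) + t * I)‖)
      ((logDeriv xiGammaFactor ((σ : ℂ) + t * I)).re) σ := by
  have hre : 0 < ((σ : ℂ) + t * I).re := by simp [hσ]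
  have hne := xiGammaFactor_ne_zero hre (ofReal_add_mul_I_ne_one ht)
  have h := hasDerivAt_log_norm (hasDerivAt_xiGammaFactor_horizontal t hσ) hne
  rw [logDeriv_apply]
  exact h

/-- **`d/dt log ‖γ̃(σ + it)‖ = −Im λ′(σ + it)`** for `σ > 0`, `t ≠ 0`. RH-FREE. [folklore] -/
theorem hasDerivAt_log_norm_xiGammaFactor_vertical {σ : ℝ} {t : ℝ} (hσ : 0 < σ) (ht : t ≠ 0) :
    HasDerivAt (fun y : ℝ => Real.log ‖xiGammaFactor ((σ : ℂ) + y * I)‖)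
      (-(logDeriv xiGammaFactor ((σ : ℂ) + t * I)).im) t := by
  have hre : 0 < ((σ : ℂ) + t * I).re := by simp [hσ]
  have hne := xiGammaFactor_ne_zero hre (ofReal_add_mul_I_ne_one ht)
  have h := hasDerivAt_log_norm (hasDerivAt_xiGammaFactor_vertical t hσ) hne
  have e : (deriv xiGammaFactor ((σ : ℂ) + t * I) * I / xiGammaFactor ((σ : ℂ) + t * I)).re =
      -(logDeriv xiGammaFactor ((σ : ℂ) + t * I)).im := by
    rw [logDeriv_apply, show deriv xiGammaFactor ((σ : ℂ) + t * I) * I /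
        xiGammaFactor ((σ : ℂ) + t * I) =
        deriv xiGammaFactor ((σ : ℂ) + t * I) / xiGammaFactor ((σ : ℂ) + t * I) * I by ring]
    simp [Complex.mul_re]
  rw [← e]
  exact h

/-! ## First-order Stirling for `Re λ′` and `Im λ′` -/

/-- **Real and imaginary parts of `λ′`:** for `Re s > 0`, `Im s ≥ 2`:
`½ log(‖s‖/2π) − 6/Im s ≤ Re λ′(s) ≤ ½ log(‖s‖/2π) + 6/Im s` and `−6/Im s ≤ Im λ′(s) ≤ π/4 + 6/Im s`
(`λ′ = ½ Log(s/2π) + E`, `‖E‖ ≤ 6/Im s`, `Im ½Log(s/2π) = ½ arg s ∈ [0, π/4]`). RH-FREE. [folklore] -/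
theorem re_im_logDeriv_xiGammaFactor_bounds {s : ℂ} (hre : 0 < s.re) (him : 2 ≤ s.im) :
    (Real.log ‖s‖ - Real.log (2 * π)) / 2 - 6 / s.im ≤ (logDeriv xiGammaFactor s).re ∧
    (logDeriv xiGammaFactor s).re ≤ (Real.log ‖s‖ - Real.log (2 * π)) / 2 + 6 / s.im ∧
    -(6 / s.im) ≤ (logDeriv xiGammaFactor s).im ∧
    (logDeriv xiGammaFactor s).im ≤ π / 4 + 6 / s.im := by
  have him0 : 0 < s.im := by linarith
  have hs0 : s ≠ 0 := fun h => by rw [h] at him0; simp at him0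
  have hs1 : s ≠ 1 := fun h => by rw [h] at him0; simp at him0
  rw [logDeriv_xiGammaFactor_of_re_pos hre hs1]
  have hE := norm_xiGammaLogDeriv_sub_half_log_le_of_re_nonneg him hre.le
  obtain ⟨hLre, hLim0, hLimπ⟩ := half_log_div_two_pi_re_im hs0 hre.le him0.le
  set L : ℂ := Complex.log (s / (2 * Real.pi)) / 2 with hL
  set Λ : ℂ := 1 / s + 1 / (s - 1) - Complex.log (Real.pi : ℂ) / 2 + Complex.digamma (s / 2) / 2
    with hΛ
  have hEre : |(Λ - L).re| ≤ 6 / s.im := (Complex.abs_re_le_norm _).trans hE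
  have hEim : |(Λ - L).im| ≤ 6 / s.im := (Complex.abs_im_le_norm _).trans hE
  rw [Complex.sub_re] at hEre
  rw [Complex.sub_im] at hEim
  have hre' := abs_le.1 hEre
  have him' := abs_le.1 hEim
  refine ⟨?_, ?_, ?_, ?_⟩ <;> linarith

/-- `Re λ′(σ + it) ≥ ℓ_t/2 − 6/t` for `σ > 0`, `t ≥ 2` (`‖s‖ ≥ t`). RH-FREE. [folklore] -/
theorem half_ell_sub_le_re_logDeriv_xiGammaFactor {σ t : ℝ} (hσ : 0 < σ) (ht : 2 ≤ t) :
    ell t / 2 - 6 / t ≤ (logDeriv xiGammaFactor ((σ : ℂ) + t * I)).re := by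
  have hre : 0 < ((σ : ℂ) + t * I).re := by simp [hσ]
  have him : 2 ≤ ((σ : ℂ) + t * I).im := by simp [ht]
  obtain ⟨h, -, -, -⟩ := re_im_logDeriv_xiGammaFactor_bounds hre him
  have hims : ((σ : ℂ) + t * I).im = t := by simp
  rw [hims] at h
  have ht0 : 0 < t := by linarith
  have hnorm : t ≤ ‖(σ : ℂ) + t * I‖ := by
    have := Complex.abs_im_le_norm ((σ : ℂ) + t * I)
    rw [hims, abs_of_pos ht0] at this
    exact this
  have hlog : Real.log t ≤ Real.log ‖(σ : ℂ) + t * I‖ := Real.log_le_log ht0 hnorm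
  have hell : ell t = Real.log t - Real.log (2 * π) := by
    rw [ell, Real.log_div ht0.ne' (by positivity)]
  rw [hell]
  linarith

/-- `Re λ′(σ + it) ≤ ½ log((σ + t)/2π) + 6/t` for `σ > 0`, `t ≥ 2` (`‖s‖ ≤ σ + t`). RH-FREE.
[folklore] -/
theorem re_logDeriv_xiGammaFactor_le {σ t : ℝ} (hσ : 0 < σ) (ht : 2 ≤ t) :
    (logDeriv xiGammaFactor ((σ : ℂ) + t * I)).re ≤ Real.log ((σ + t) / (2 * π)) / 2 + 6 / t := by
  have hre : 0 < ((σ : ℂ) + t * I).re := by simp [hσ]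
  have him : 2 ≤ ((σ : ℂ) + t * I).im := by simp [ht]
  obtain ⟨-, h, -, -⟩ := re_im_logDeriv_xiGammaFactor_bounds hre him
  have hims : ((σ : ℂ) + t * I).im = t := by simp
  rw [hims] at h
  have ht0 : 0 < t := by linarith
  have hnorm : ‖(σ : ℂ) + t * I‖ ≤ σ + t := by
    calc ‖(σ : ℂ) + t * I‖ ≤ ‖(σ : ℂ)‖ + ‖(t : ℂ) * I‖ := norm_add_le _ _
      _ = σ + t := by
        rw [Complex.norm_real, norm_mul, Complex.norm_I, mul_one, Complex.norm_real,
          Real.norm_eq_abs, Real.norm_eq_abs, abs_of_pos hσ, abs_of_pos ht0]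
  have hpos : 0 < ‖(σ : ℂ) + t * I‖ := by
    have := Complex.abs_im_le_norm ((σ : ℂ) + t * I)
    rw [hims, abs_of_pos ht0] at this
    linarith
  have hlog : Real.log ‖(σ : ℂ) + t * I‖ ≤ Real.log (σ + t) := Real.log_le_log hpos hnorm
  have hdiv : Real.log ((σ + t) / (2 * π)) = Real.log (σ + t) - Real.log (2 * π) := by
    rw [Real.log_div (by linarith) (by positivity)]
  rw [hdiv]
  linarith

/-- `−π/4 − 6/t ≤ −Im λ′(σ + it) ≤ 6/t` for `σ > 0`, `t ≥ 2`. RH-FREE. [folklore] -/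
theorem neg_im_logDeriv_xiGammaFactor_bounds {σ t : ℝ} (hσ : 0 < σ) (ht : 2 ≤ t) :
    -(π / 4) - 6 / t ≤ -(logDeriv xiGammaFactor ((σ : ℂ) + t * I)).im ∧
    -(logDeriv xiGammaFactor ((σ : ℂ) + t * I)).im ≤ 6 / t := by
  have hre : 0 < ((σ : ℂ) + t * I).re := by simp [hσ]
  have him : 2 ≤ ((σ : ℂ) + t * I).im := by simp [ht]
  obtain ⟨-, -, h1, h2⟩ := re_im_logDeriv_xiGammaFactor_bounds hre him
  have hims : ((σ : ℂ) + t * I).im = t := by simp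
  rw [hims] at h1 h2
  constructor <;> linarith

/-! ## Horizontal comparison -/

/-- **Horizontal monotonicity of `‖γ̃‖` (decreasing to the left):** for `0 < σ₁ ≤ σ₂` and `t ≥ 2`,
`‖γ̃(σ₁ + it)‖ ≤ ‖γ̃(σ₂ + it)‖ · exp(−(σ₂ − σ₁)(ℓ_t/2 − 6/t))`, `ℓ_t = log(t/2π)` — the mean value
theorem for `σ ↦ log ‖γ̃(σ+it)‖` with `Re λ′ ≥ ℓ_t/2 − 6/t`. In the far zone of the BAND line this
is the factor `e^{−aℓ}` between the two windows and `e^{−δ₁ℓ}` between `σ = 1+δ₁` and the own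
window `σ* ≥ 1+3δ₁`. RH-FREE. [folklore] -/
theorem norm_xiGammaFactor_le_of_re_le {σ₁ σ₂ t : ℝ} (hσ₁ : 0 < σ₁) (h12 : σ₁ ≤ σ₂) (ht : 2 ≤ t) :
    ‖xiGammaFactor ((σ₁ : ℂ) + t * I)‖ ≤
      ‖xiGammaFactor ((σ₂ : ℂ) + t * I)‖ * Real.exp (-((σ₂ - σ₁) * (ell t / 2 - 6 / t))) := by
  have ht0 : t ≠ 0 := by intro h; rw [h] at ht; norm_num at ht
  set f : ℝ → ℝ := fun x => Real.log ‖xiGammaFactor ((x : ℂ) + t * I)‖ with hf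
  have hpos : ∀ x : ℝ, 0 < x → 0 < ‖xiGammaFactor ((x : ℂ) + t * I)‖ := by
    intro x hx
    have hre : 0 < ((x : ℂ) + t * I).re := by simp [hx]
    exact norm_pos_iff.2 (xiGammaFactor_ne_zero hre (ofReal_add_mul_I_ne_one ht0))
  rcases eq_or_lt_of_le h12 with heq | hlt
  · rw [heq]; simp
  have hderiv : ∀ x ∈ Icc σ₁ σ₂, HasDerivAt f ((logDeriv xiGammaFactor ((x : ℂ) + t * I)).re) x := by
    intro x hx
    exact hasDerivAt_log_norm_xiGammaFactor_horizontal (hσ₁.trans_le hx.1) ht0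
  have hcont : ContinuousOn f (Icc σ₁ σ₂) :=
    fun x hx => (hderiv x hx).continuousAt.continuousWithinAt
  obtain ⟨c, hc, hslope⟩ := exists_hasDerivAt_eq_slope f
    (fun x => (logDeriv xiGammaFactor ((x : ℂ) + t * I)).re) hlt hcont
    (fun x hx => hderiv x (Ioo_subset_Icc_self hx))
  have hc0 : 0 < c := hσ₁.trans hc.1
  have hlow := half_ell_sub_le_re_logDeriv_xiGammaFactor hc0 ht
  rw [hslope, le_div_iff₀ (by linarith)] at hlow
  -- `f σ₁ ≤ f σ₂ − (σ₂−σ₁)m`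
  have hf1 : f σ₁ = Real.log ‖xiGammaFactor ((σ₁ : ℂ) + t * I)‖ := rfl
  have hf2 : f σ₂ = Real.log ‖xiGammaFactor ((σ₂ : ℂ) + t * I)‖ := rfl
  have h1 := hpos σ₁ hσ₁
  have h2 := hpos σ₂ (hσ₁.trans_le h12)
  calc ‖xiGammaFactor ((σ₁ : ℂ) + t * I)‖ = Real.exp (f σ₁) := by rw [hf1, Real.exp_log h1]
    _ ≤ Real.exp (f σ₂ + -((σ₂ - σ₁) * (ell t / 2 - 6 / t))) := Real.exp_le_exp.2 (by linarith)
    _ = ‖xiGammaFactor ((σ₂ : ℂ) + t * I)‖ * Real.exp (-((σ₂ - σ₁) * (ell t / 2 - 6 / t))) := by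
        rw [Real.exp_add, hf2, Real.exp_log h2]

/-- **Horizontal comparison, reverse direction:** for `0 < σ₁ ≤ σ₂` and `t ≥ 2`,
`‖γ̃(σ₂ + it)‖ ≤ ‖γ̃(σ₁ + it)‖ · exp((σ₂ − σ₁)(½ log((σ₂ + t)/2π) + 6/t))`. RH-FREE. [folklore] -/
theorem norm_xiGammaFactor_le_of_le_re {σ₁ σ₂ t : ℝ} (hσ₁ : 0 < σ₁) (h12 : σ₁ ≤ σ₂) (ht : 2 ≤ t) :
    ‖xiGammaFactor ((σ₂ : ℂ) + t * I)‖ ≤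
      ‖xiGammaFactor ((σ₁ : ℂ) + t * I)‖ *
        Real.exp ((σ₂ - σ₁) * (Real.log ((σ₂ + t) / (2 * π)) / 2 + 6 / t)) := by
  have ht0 : t ≠ 0 := by intro h; rw [h] at ht; norm_num at ht
  have ht2 : 0 < t := by linarith
  set f : ℝ → ℝ := fun x => Real.log ‖xiGammaFactor ((x : ℂ) + t * I)‖ with hf
  have hpos : ∀ x : ℝ, 0 < x → 0 < ‖xiGammaFactor ((x : ℂ) + t * I)‖ := by
    intro x hx
    have hre : 0 < ((x : ℂ) + t * I).re := by simp [hx]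
    exact norm_pos_iff.2 (xiGammaFactor_ne_zero hre (ofReal_add_mul_I_ne_one ht0))
  rcases eq_or_lt_of_le h12 with heq | hlt
  · rw [heq]; simp
  have hderiv : ∀ x ∈ Icc σ₁ σ₂, HasDerivAt f ((logDeriv xiGammaFactor ((x : ℂ) + t * I)).re) x := by
    intro x hx
    exact hasDerivAt_log_norm_xiGammaFactor_horizontal (hσ₁.trans_le hx.1) ht0
  have hcont : ContinuousOn f (Icc σ₁ σ₂) :=
    fun x hx => (hderiv x hx).continuousAt.continuousWithinAt
  obtain ⟨c, hc, hslope⟩ := exists_hasDerivAt_eq_slope f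
    (fun x => (logDeriv xiGammaFactor ((x : ℂ) + t * I)).re) hlt hcont
    (fun x hx => hderiv x (Ioo_subset_Icc_self hx))
  have hc0 : 0 < c := hσ₁.trans hc.1
  have hup := re_logDeriv_xiGammaFactor_le hc0 ht
  -- `log((c+t)/2π) ≤ log((σ₂+t)/2π)`
  have hmono : Real.log ((c + t) / (2 * π)) ≤ Real.log ((σ₂ + t) / (2 * π)) := by
    apply Real.log_le_log (by positivity)
    apply div_le_div_of_nonneg_right _ (by positivity)
    linarith [hc.2]
  rw [hslope] at hup
  have hup' : (f σ₂ - f σ₁) / (σ₂ - σ₁) ≤ Real.log ((σ₂ + t) / (2 * π)) / 2 + 6 / t := by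
    linarith
  rw [div_le_iff₀ (by linarith)] at hup'
  have hf1 : f σ₁ = Real.log ‖xiGammaFactor ((σ₁ : ℂ) + t * I)‖ := rfl
  have hf2 : f σ₂ = Real.log ‖xiGammaFactor ((σ₂ : ℂ) + t * I)‖ := rfl
  have h1 := hpos σ₁ hσ₁
  have h2 := hpos σ₂ (hσ₁.trans_le h12)
  calc ‖xiGammaFactor ((σ₂ : ℂ) + t * I)‖ = Real.exp (f σ₂) := by rw [hf2, Real.exp_log h2]
    _ ≤ Real.exp (f σ₁ + (σ₂ - σ₁) * (Real.log ((σ₂ + t) / (2 * π)) / 2 + 6 / t)) :=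
        Real.exp_le_exp.2 (by linarith)
    _ = ‖xiGammaFactor ((σ₁ : ℂ) + t * I)‖ *
        Real.exp ((σ₂ - σ₁) * (Real.log ((σ₂ + t) / (2 * π)) / 2 + 6 / t)) := by
        rw [Real.exp_add, hf1, Real.exp_log h1]

/-! ## Vertical comparison -/

/-- **Vertical comparison of `‖γ̃‖`:** for `σ > 0` and `2 ≤ t₁ ≤ t₂`,
`‖γ̃(σ + it₂)‖ ≤ ‖γ̃(σ + it₁)‖ · e^{(6/t₁)(t₂ − t₁)}` and
`‖γ̃(σ + it₁)‖ ≤ ‖γ̃(σ + it₂)‖ · e^{(π/4 + 6/t₁)(t₂ − t₁)}` (mean value theorem with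
`d/dt log‖γ̃‖ = −Im λ′ ∈ [−π/4 − 6/t, 6/t]`). On one arc of the BAND line the heights differ by at
most `2h = O(1)` in the far zone, so these are bounded factors. RH-FREE. [folklore] -/
theorem norm_xiGammaFactor_vertical_le {σ t₁ t₂ : ℝ} (hσ : 0 < σ) (ht₁ : 2 ≤ t₁) (h12 : t₁ ≤ t₂) :
    ‖xiGammaFactor ((σ : ℂ) + t₂ * I)‖ ≤
      ‖xiGammaFactor ((σ : ℂ) + t₁ * I)‖ * Real.exp (6 / t₁ * (t₂ - t₁)) ∧
    ‖xiGammaFactor ((σ : ℂ) + t₁ * I)‖ ≤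
      ‖xiGammaFactor ((σ : ℂ) + t₂ * I)‖ * Real.exp ((π / 4 + 6 / t₁) * (t₂ - t₁)) := by
  have hre : ∀ y : ℝ, 0 < ((σ : ℂ) + y * I).re := by intro y; simp [hσ]
  have hpos : ∀ y : ℝ, y ≠ 0 → 0 < ‖xiGammaFactor ((σ : ℂ) + y * I)‖ := by
    intro y hy
    exact norm_pos_iff.2 (xiGammaFactor_ne_zero (hre y) (ofReal_add_mul_I_ne_one hy))
  have ht10 : t₁ ≠ 0 := by intro h; rw [h] at ht₁; norm_num at ht₁
  have ht20 : t₂ ≠ 0 := by intro h; rw [h] at h12; linarith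
  have h1 := hpos t₁ ht10
  have h2 := hpos t₂ ht20
  rcases eq_or_lt_of_le h12 with heq | hlt
  · rw [← heq]; simp
  set g : ℝ → ℝ := fun y => Real.log ‖xiGammaFactor ((σ : ℂ) + y * I)‖ with hg
  have hderiv : ∀ y ∈ Icc t₁ t₂,
      HasDerivAt g (-(logDeriv xiGammaFactor ((σ : ℂ) + y * I)).im) y := by
    intro y hy
    have hy0 : y ≠ 0 := by intro h; rw [h] at hy; linarith [hy.1]
    exact hasDerivAt_log_norm_xiGammaFactor_vertical hσ hy0
  have hcont : ContinuousOn g (Icc t₁ t₂) :=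
    fun y hy => (hderiv y hy).continuousAt.continuousWithinAt
  obtain ⟨c, hc, hslope⟩ := exists_hasDerivAt_eq_slope g
    (fun y => -(logDeriv xiGammaFactor ((σ : ℂ) + y * I)).im) hlt hcont
    (fun y hy => hderiv y (Ioo_subset_Icc_self hy))
  have hc2 : 2 ≤ c := ht₁.trans hc.1.le
  obtain ⟨hlo, hhi⟩ := neg_im_logDeriv_xiGammaFactor_bounds hσ hc2
  rw [hslope] at hlo hhi
  have hc0 : 0 < c := by linarith
  have ht1pos : 0 < t₁ := by linarith
  -- `6/c ≤ 6/t₁`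
  have h6 : 6 / c ≤ 6 / t₁ := div_le_div_of_nonneg_left (by norm_num) ht1pos hc.1.le
  have hd : 0 < t₂ - t₁ := by linarith
  have hhi' : g t₂ - g t₁ ≤ 6 / t₁ * (t₂ - t₁) := by
    rw [div_le_iff₀ hd] at hhi
    nlinarith
  have hlo' : -(π / 4 + 6 / t₁) * (t₂ - t₁) ≤ g t₂ - g t₁ := by
    rw [le_div_iff₀ hd] at hlo
    nlinarith
  have hg1 : g t₁ = Real.log ‖xiGammaFactor ((σ : ℂ) + t₁ * I)‖ := rfl
  have hg2 : g t₂ = Real.log ‖xiGammaFactor ((σ : ℂ) + t₂ * I)‖ := rfl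
  constructor
  · calc ‖xiGammaFactor ((σ : ℂ) + t₂ * I)‖ = Real.exp (g t₂) := by rw [hg2, Real.exp_log h2]
      _ ≤ Real.exp (g t₁ + 6 / t₁ * (t₂ - t₁)) := Real.exp_le_exp.2 (by linarith)
      _ = ‖xiGammaFactor ((σ : ℂ) + t₁ * I)‖ * Real.exp (6 / t₁ * (t₂ - t₁)) := by
          rw [Real.exp_add, hg1, Real.exp_log h1]
  · calc ‖xiGammaFactor ((σ : ℂ) + t₁ * I)‖ = Real.exp (g t₁) := by rw [hg1, Real.exp_log h1]
      _ ≤ Real.exp (g t₂ + (π / 4 + 6 / t₁) * (t₂ - t₁)) := Real.exp_le_exp.2 (by linarith)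
      _ = ‖xiGammaFactor ((σ : ℂ) + t₂ * I)‖ * Real.exp ((π / 4 + 6 / t₁) * (t₂ - t₁)) := by
          rw [Real.exp_add, hg2, Real.exp_log h2]

end Summit.RiemannHypothesis.RiemannHypothesis.Theorems.JensenPolynomials.LogBandArc

end
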